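import Mathlib
import Literature.NumberTheory.LFunctions.Zhang2022.Section11AFEAssembly
import HarnessLib

/-!
# Zhang (2022) §11, proof of Lemma 11.2 for `χψ` on the WIDENED height range `|t − 2πt₀| < 𝓛₁ + 2`
# — the blocks (b) pole shift, (c) line split, (g) dual tail, (B2) the window via Lemma 5.1

Topic `Literature/NumberTheory/LFunctions/Zhang2022` (Landau–Siegel audit tree; verdict-neutral).
Y. Zhang, *Discrete mean estimates and the Landau–Siegel zero*, arXiv:2211.02515v1 (2022)
[Zhang2022LandauSiegel] — **an unrefereed manuscript under adjudication** (campaign D-0069 /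
ZHANG-L discharge lane, WP12 helper H2-B; nothing here bears on Theorems 1–2 or on Landau–Siegel
zeros). Companion of `Section11AFEShiftPole` / `Section11AFELineSplit` / `Section11AFEDualTail` /
`Section11AFEBlocks` (sub-steps (b), (c), (g) and block (B2) of `Z22:§11.u024`, the first display of
the proof of Lemma 11.2, "in a way similar to the proof of Lemma 6.1").

WHY. §12 p. 67 (tex L3426–3429, `Z22:§12.u009`) applies "the proof of Lemma 11.2 with `s + β₆` in
place of `s`"; `s + β₆` leaves the typed range `InRange112` (`|t − 2πt₀| < 𝓛₁`) by up to `3α/2`.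
Sub-steps (b), (c) use only `σ = 1/2`; (g) uses `t > 0`; (B2) uses Lemma 5.1's range `InRange51`
(`|t − 2πt₀| < 𝓛₁ + 2`). This file re-runs them VERBATIM with the height condition widened to
`|t − 2πt₀| < 𝓛₁ + 2` (twins, suffix `_wide`; (b), (c) stated with NO height condition).
Theorem-only; 0 new definitions, 0 new facts.

* `shiftPole11_wide` — (b): `∫_{(1)} = L(s,χψ) + ∫_{(−1)}` for `σ = 1/2`;
* `lineSplit11_wide` — (c): the functional-equation split on `u = −1`;
* `dualTail11_wide` — (g): completing the dual head `n < P₁` costs `≤ e^{−𝓛¹⁰}`;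
* `norm_vseg_integrandDiff_le_wide` — (B2): the `u = 0` window is `≤ C·E₂(s,ψ)`.

## References

* Y. Zhang, arXiv:2211.02515v1 (2022), §6 proof of Lemma 6.1 pp. 31–32; §11 Lemma 11.2 p. 65;
  §12 p. 67; §5 Lemma 5.1; §4 (4.3). [cite: Zhang2022LandauSiegel, §6 Lemma 6.1; §11 Lemma 11.2; §12 p.67]
-/

noncomputable section

open Complex Real ComplexConjugate MeasureTheory Set Filter Topology

namespace Literature.NumberTheory.LFunctions.Zhang2022.Section11AFE

open Skeleton GaussWeight Section6Statements

section BlocksWide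

variable {D : ℕ} [NeZero D] (χ : DirichletCharacter ℂ D) (x : Chr D)

/-! ## §1. (b) the pole shift, for `σ = 1/2` (no height condition) -/

omit [NeZero D] in
/-- Shifting a vertical line integral across a pole-free strip under a uniform `O(1/(1+y²))`
bound (corollary of the tree's `Literature.Analysis.Complex.integral_vertical_eq_of_differentiableOn`;
adapted from the tree's `HorocycleRHMellinShift.integral_vertical_eq_of_norm_le_div`). [folklore] -/
private theorem integral_vertical_eq_of_norm_le_div_wide {f : ℂ → ℂ} {σ₁ σ₂ C : ℝ} (hσ : σ₁ ≤ σ₂)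
    (hd : DifferentiableOn ℂ f (Complex.re ⁻¹' Set.Icc σ₁ σ₂))
    (hb : ∀ x y : ℝ, x ∈ Set.Icc σ₁ σ₂ → ‖f (x + y * I)‖ ≤ C / (1 + y ^ 2)) :
    ∫ y : ℝ, f (σ₁ + y * I) = ∫ y : ℝ, f (σ₂ + y * I) := by
  have hC0 : 0 ≤ C := by
    have h := (norm_nonneg _).trans (hb σ₁ 0 (Set.left_mem_Icc.2 hσ))
    simpa using h
  have hint : ∀ x ∈ Set.Icc σ₁ σ₂, Integrable fun y : ℝ => f (x + y * I) := by
    intro x hx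
    have hcont : Continuous fun y : ℝ => f (x + y * I) := by
      refine hd.continuousOn.comp_continuous (by fun_prop) ?_
      intro y
      simpa using hx
    refine Integrable.mono' ((integrable_inv_one_add_sq).const_mul C) hcont.aestronglyMeasurable ?_
    filter_upwards with y
    simpa [div_eq_mul_inv] using hb x y hx
  refine Literature.Analysis.Complex.integral_vertical_eq_of_differentiableOn hσ hd
    (hint σ₁ (Set.left_mem_Icc.2 hσ)) (hint σ₂ (Set.right_mem_Icc.2 hσ)) fun ε hε => ?_
  refine ⟨max (C / ε) 1, fun T hT x hx => (hb x T hx).trans ?_⟩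
  have hT1 : 1 ≤ |T| := (le_max_right _ _).trans hT
  have hT2 : C / ε ≤ |T| := (le_max_left _ _).trans hT
  rw [div_le_iff₀ (by positivity)]
  have h1 : C ≤ ε * |T| := by rwa [div_le_iff₀' hε] at hT2
  have h2 : |T| ≤ 1 + T ^ 2 := by nlinarith [sq_abs T, abs_nonneg T]
  nlinarith

/-- **(b) on every height** (twin of `shiftPole11_holds`, which uses only `σ = 1/2`): for `D ≥ 3`,
`ψ ∈ Ψ`, `σ = 1/2`, `0.5 ≤ z ≤ 0.504`: `∫_{(1)} L(s+w,χψ)P^{zw}ω₁(w)dw/w = L(s,χψ) + ∫_{(−1)}(same)`.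
[cite: Zhang2022LandauSiegel, §6 p. 31, tex L1711; §11 p. 65; §12 p. 67] -/
theorem shiftPole11_wide : ForAllLarge fun D _ χ => ∀ x : Chr D, ∀ s : ℂ, s.re = 1 / 2 →
    ∀ z : ℝ, 0.5 ≤ z → z ≤ 0.504 →
      vline (integrandL χ x (bigP D ^ z) s) 1 =
        (psiChi χ x).LFunction s + vline (integrandL χ x (bigP D ^ z) s) (-1) := by
  refine ⟨3, fun D _ χ hD _hq hp x s hre z _hz1 _hz2 => ?_⟩
  have hD2 : 2 ≤ D := le_trans (by norm_num) hD
  have hP : 0 < bigP D := Real.exp_pos _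
  set X : ℝ := bigP D ^ z with hXdef
  have hX : 0 < X := Real.rpow_pos_of_pos hP z
  have hGd := differentiable_poleRemoved χ x hD hp s hX
  obtain ⟨C, hC⟩ := exists_norm_poleRemoved_le χ x hD hp hre hX
  obtain ⟨hk1, hk2, hki1, hki2⟩ := integral_kern_lines (D := D) hD2 hX
  set L0 : ℂ := (psiChi χ x).LFunction s with hL0
  -- the shift for `G`
  have hshift : ∫ y : ℝ, poleRemoved χ x X s ((-1 : ℝ) + y * I) =
      ∫ y : ℝ, poleRemoved χ x X s ((1 : ℝ) + y * I) :=
    integral_vertical_eq_of_norm_le_div_wide (by norm_num) hGd.differentiableOn hC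
  -- integrability of `G` on the two lines
  have hC0 : 0 ≤ C := by
    have h := hC 0 0 (by simp)
    have : (0 : ℝ) ≤ C / (1 + 0 ^ 2) := le_trans (norm_nonneg _) h
    simpa using this
  have hGi : ∀ c : ℝ, c ∈ Set.Icc (-1 : ℝ) 1 →
      Integrable fun y : ℝ => poleRemoved χ x X s ((c : ℂ) + (y : ℂ) * I) := by
    intro c hc
    have hcont : Continuous fun y : ℝ => poleRemoved χ x X s ((c : ℂ) + (y : ℂ) * I) :=
      hGd.continuous.comp (by fun_prop)
    refine Integrable.mono' ((integrable_inv_one_add_sq).const_mul C) hcont.aestronglyMeasurable ?_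
    filter_upwards with y
    simpa [div_eq_mul_inv] using hC c y hc
  -- the integrand on each line
  have e1 : (fun v : ℝ => integrandL χ x X s (((1 : ℝ) : ℂ) + (v : ℂ) * I)) = fun v : ℝ =>
      poleRemoved χ x X s (((1 : ℝ) : ℂ) + (v : ℂ) * I) + L0 * kern D X (((1 : ℝ) : ℂ) + (v : ℂ) * I) := by
    funext v
    exact integrandL_eq_poleRemoved_add χ x X s (by
      intro h; have := congrArg Complex.re h; simp at this)
  have e2 : (fun v : ℝ => integrandL χ x X s (((-1 : ℝ) : ℂ) + (v : ℂ) * I)) = fun v : ℝ =>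
      poleRemoved χ x X s (((-1 : ℝ) : ℂ) + (v : ℂ) * I) + L0 * kern D X (((-1 : ℝ) : ℂ) + (v : ℂ) * I) := by
    funext v
    exact integrandL_eq_poleRemoved_add χ x X s (by
      intro h; have := congrArg Complex.re h; simp at this)
  have hg1 : (gW D X⁻¹ : ℂ) = 1 - (gW D X : ℂ) := by
    have h' : gW D X⁻¹ = 1 - gW D X := by linarith [gW_add_gW_inv (D := D) hD2 X]
    rw [h']; push_cast; ring
  have hπ : (2 * π : ℂ) ≠ 0 := by
    exact mul_ne_zero two_ne_zero (Complex.ofReal_ne_zero.mpr Real.pi_ne_zero)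
  rw [vline, vline, e1, e2, integral_add (hGi 1 (by norm_num)) (hki1.const_mul _),
    integral_add (hGi (-1) (by norm_num)) (hki2.const_mul _), integral_const_mul,
    integral_const_mul, hk1, hk2, hg1]
  rw [hshift]
  set J : ℂ := ∫ y : ℝ, poleRemoved χ x X s (((1 : ℝ) : ℂ) + (y : ℂ) * I) with hJ
  field_simp
  ring

/-! ## §2. (c) the line split, for `σ = 1/2` (no height condition) -/

/-- **(c) on every height** (twin of `lineSplit11_holds`, which uses only `σ = 1/2`): for `D ≥ 3`,
the functional-equation split of `∫_{(−1)}` into head/tail and main/difference pieces.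
[cite: Zhang2022LandauSiegel, §6 p. 31, tex L1724, L1754; §11 p. 65; §12 p. 67] -/
theorem lineSplit11_wide : ForAllLarge fun D _ χ => ∀ x : Chr D, ∀ s : ℂ, s.re = 1 / 2 →
    ∀ z : ℝ, 0.5 ≤ z → z ≤ 0.504 →
      vline (integrandL χ x (bigP D ^ z) s) (-1) =
          vline (integrandHead χ x (bigP D ^ z) (Skeleton.P1 D) s) (-1) +
            vline (integrandTail χ x (bigP D ^ z) (Skeleton.P1 D) s) (-1) ∧
        vline (integrandHead χ x (bigP D ^ z) (Skeleton.P1 D) s) (-1) =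
          vline (integrandMain χ x (bigP D ^ z) (Skeleton.P1 D) s) (-1) +
            vline (integrandDiff χ x (bigP D ^ z) (Skeleton.P1 D) s) (-1) := by
  refine ⟨3, fun D _ χ hD _hq hp x s hre z _hz1 _hz2 => ?_⟩
  have hD2 : 2 ≤ D := le_trans (by norm_num) hD
  have hP : 0 < bigP D := Real.exp_pos _
  have hX : 0 < bigP D ^ z := Real.rpow_pos_of_pos hP z
  have hℓ : 0 < ell D := by
    have : (1 : ℝ) < D := by exact_mod_cast lt_of_lt_of_le (by norm_num) hD2
    exact Real.log_pos this
  have hR : 0 < bigR D := by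
    rw [bigR]
    have : (0 : ℝ) < D := by exact_mod_cast lt_of_lt_of_le (by norm_num) hD2
    exact mul_pos (mul_pos this hP) (pow_pos hℓ _)
  set X := bigP D ^ z
  set N := Skeleton.P1 D
  have e1 : (fun v : ℝ => integrandL χ x X s (((-1 : ℝ) : ℂ) + (v : ℂ) * I)) = fun v : ℝ =>
      integrandHead χ x X N s (((-1 : ℝ) : ℂ) + (v : ℂ) * I) +
        integrandTail χ x X N s (((-1 : ℝ) : ℂ) + (v : ℂ) * I) := by
    funext v
    rw [integrandL, integrandHead, integrandTail, feSplit_neg_one χ x hD hp hre N v]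
    ring
  have e2 : (fun v : ℝ => integrandHead χ x X N s (((-1 : ℝ) : ℂ) + (v : ℂ) * I)) = fun v : ℝ =>
      integrandMain χ x X N s (((-1 : ℝ) : ℂ) + (v : ℂ) * I) +
        integrandDiff χ x X N s (((-1 : ℝ) : ℂ) + (v : ℂ) * I) := by
    funext v
    simp only [integrandHead, integrandMain, integrandDiff]
    ring
  have iH := integrable_integrandHead χ x hD2 hre hX N
  have iT := integrable_integrandTail χ x hD2 hre hX N
  have iM := integrable_integrandMain χ x hD2 hre hX hR N
  have iD : Integrable fun v : ℝ => integrandDiff χ x X N s (((-1 : ℝ) : ℂ) + (v : ℂ) * I) := by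
    have : (fun v : ℝ => integrandDiff χ x X N s (((-1 : ℝ) : ℂ) + (v : ℂ) * I)) = fun v : ℝ =>
        integrandHead χ x X N s (((-1 : ℝ) : ℂ) + (v : ℂ) * I) -
          integrandMain χ x X N s (((-1 : ℝ) : ℂ) + (v : ℂ) * I) := by
      funext v
      have h2 := congrFun e2 v
      rw [h2]; ring
    rw [this]; exact iH.sub iM
  constructor
  · rw [vline, vline, vline, e1, integral_add iH iT]; ring
  · rw [vline, vline, vline, e2, integral_add iM iD]; ring

/-! ## §3. (g) the dual tail, widened range -/

/-- **(g) on the widened range** (twin of `dualTail11_holds`, `c = C = 1`, `D ≥ e⁵`): for `ψ ∈ Ψ`,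
`σ = 1/2`, `|t − 2πt₀| < 𝓛₁ + 2`, `0.5 ≤ z ≤ 0.504`: completing the dual head `n < P₁` to the dual sum
costs `≤ e^{−𝓛¹⁰}` (`|Z(s,χψ)| = 1`, (4.3)). [cite: Zhang2022LandauSiegel, §4 (4.3); §11 p. 65; §12 p. 67] -/
theorem dualTail11_wide :
    ∃ c : ℝ, 0 < c ∧ ∃ C : ℝ, ForAllLarge fun D _ χ => ∀ x : Chr D, ∀ s : ℂ, s.re = 1 / 2 →
      |s.im - 2 * π * t0 D| < ell1 D + 2 → ∀ z : ℝ, 0.5 ≤ z → z ≤ 0.504 →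
        ‖Zpc χ x s * (dualSum χ x (bigR D / bigP D ^ z) s -
            dualHead χ x (bigR D / bigP D ^ z) (Skeleton.P1 D) s)‖ ≤ C * Real.exp (-c * ell D ^ 10) := by
  refine ⟨1, one_pos, 1, ⌈Real.exp 5⌉₊, fun D _ χ hD _hq hp x s hre him z hz1 hz2 => ?_⟩
  -- `𝓛 ≥ 5`, `D ≥ 3`
  have hexp : Real.exp 5 ≤ D := le_trans (Nat.le_ceil _) (by exact_mod_cast hD)
  have hL : 5 ≤ ell D := (Real.le_log_iff_exp_le (lt_of_lt_of_le (Real.exp_pos _) hexp)).mpr hexp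
  have hL1 : 1 ≤ ell D := by linarith
  have hD3 : 3 ≤ D := by
    have h3 : (3 : ℝ) ≤ Real.exp 5 := by
      have := Real.add_one_le_exp (5 : ℝ); linarith
    exact_mod_cast h3.trans hexp
  -- `|Z(s,χψ)| = 1`
  have hsim : 0 < s.im := by
    have h1 := (abs_lt.mp him).1
    have h405 : ell D ^ 405 ≤ ell D ^ 519 := pow_le_pow_right₀ hL1 (by norm_num)
    rw [ell1] at h1; rw [t0] at h1
    have hpi : 6 * ell D ^ 519 ≤ 2 * π * ell D ^ 519 :=
      mul_le_mul_of_nonneg_right (by linarith [Real.pi_gt_three]) (by positivity)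
    have h519 : (1 : ℝ) ≤ ell D ^ 519 := one_le_pow₀ hL1
    linarith
  have hZ : ‖Zpc χ x s‖ = 1 := norm_Zpc_eq_one χ (psiChiPrimitive_holds D χ x hD3 hp) hre hsim
  -- the summand and its shift
  set Y := bigR D / bigP D ^ z with hYdef
  set Nn : ℕ := ⌈Skeleton.P1 D⌉₊ with hNn
  set f : ℕ → ℂ := fun n => conj (pc χ x n) * (n : ℂ) ^ (-(1 - s)) * (gW D (Y / n) : ℂ) with hf
  have hP : 0 < bigP D := Real.exp_pos _
  have hNn1 : 1 ≤ Nn := Nat.one_le_iff_ne_zero.mpr (Nat.pos_iff_ne_zero.mp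
    (Nat.ceil_pos.mpr (Real.rpow_pos_of_pos hP _)))
  have hpc0 : pc χ x 0 = 0 := by
    haveI : Fact (1 < D) := ⟨by omega⟩
    rw [pc, Nat.cast_zero, Nat.cast_zero, MulChar.map_nonunit χ not_isUnit_zero, mul_zero]
  have hf0 : f 0 = 0 := by simp [hf, hpc0]
  -- the bound `‖f (n + Nn)‖ ≤ ½e^{−𝓛¹⁰}/(n+1)²`
  set A : ℝ := (1 / 2) * Real.exp (-(ell D ^ 10)) with hA
  have hA0 : 0 ≤ A := by positivity
  have hbound : ∀ n : ℕ, ‖f (n + Nn)‖ ≤ A * (1 / ((n : ℝ) + 1) ^ 2) := by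
    intro n
    have hle : Nn ≤ n + Nn := Nat.le_add_left _ _
    have h := norm_dual_term_le χ x hL hre hz1 hz2 hle
    refine h.trans ?_
    rw [hA]
    have hn1 : ((n : ℝ) + 1) ^ 2 ≤ ((n + Nn : ℕ) : ℝ) ^ 2 := by
      have : (n : ℝ) + 1 ≤ ((n + Nn : ℕ) : ℝ) := by push_cast; exact_mod_cast (by omega : n + 1 ≤ n + Nn)
      exact pow_le_pow_left₀ (by positivity) this 2
    have : (((n + Nn : ℕ) : ℝ) ^ 2)⁻¹ ≤ 1 / ((n : ℝ) + 1) ^ 2 := by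
      rw [one_div]; exact inv_anti₀ (by positivity) hn1
    exact mul_le_mul_of_nonneg_left this (by positivity)
  -- summability
  have hzeta : HasSum (fun n : ℕ => (1 : ℝ) / ((n : ℝ) + 1) ^ 2) (π ^ 2 / 6) := by
    have h' := (hasSum_nat_add_iff' 1).mpr hasSum_zeta_two
    simp only [Finset.range_one, Finset.sum_singleton, Nat.cast_zero, ne_eq, OfNat.ofNat_ne_zero,
      not_false_eq_true, zero_pow, div_zero, sub_zero, Nat.cast_add, Nat.cast_one] at h'
    exact h'
  have hsumg : Summable (fun n : ℕ => A * (1 / ((n : ℝ) + 1) ^ 2)) := hzeta.summable.mul_left A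
  have hsf_shift : Summable (fun n : ℕ => ‖f (n + Nn)‖) :=
    Summable.of_nonneg_of_le (fun n => norm_nonneg _) hbound hsumg
  have hsf : Summable f := by
    have h1 : Summable (fun n : ℕ => f (n + Nn)) := hsf_shift.of_norm
    exact (summable_nat_add_iff Nn).mp h1
  -- `dualSum − dualHead = Σ_{n≥Nn} f`
  have hsplit : dualSum χ x Y s - dualHead χ x Y (Skeleton.P1 D) s = ∑' n : ℕ, f (n + Nn) := by
    have h1 := hsf.sum_add_tsum_nat_add Nn
    have h01 : ∑ i ∈ Finset.Ico 0 1, f i = 0 := by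
      rw [Finset.sum_Ico_eq_sum_range]; simp [hf0]
    have h2 : ∑ i ∈ Finset.range Nn, f i = dualHead χ x Y (Skeleton.P1 D) s := by
      rw [dualHead, Finset.range_eq_Ico, ← Finset.sum_Ico_consecutive f (Nat.zero_le 1) hNn1, h01,
        zero_add]
    rw [dualSum, ← h1, h2]
    ring
  -- conclude
  rw [norm_mul, hZ, one_mul, hsplit]
  calc ‖∑' n : ℕ, f (n + Nn)‖ ≤ ∑' n : ℕ, ‖f (n + Nn)‖ := norm_tsum_le_tsum_norm hsf_shift
    _ ≤ ∑' n : ℕ, A * (1 / ((n : ℝ) + 1) ^ 2) := hsf_shift.tsum_le_tsum hbound hsumg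
    _ = A * (π ^ 2 / 6) := by rw [tsum_mul_left, hzeta.tsum_eq]
    _ ≤ 1 * Real.exp (-1 * ell D ^ 10) := by
        rw [hA, neg_one_mul, one_mul]
        have hπ : π ^ 2 / 6 ≤ 2 := by nlinarith [Real.pi_lt_d2, Real.pi_pos]
        nlinarith [Real.exp_pos (-(ell D ^ 10))]

/-! ## §4. (B2) the `u = 0` window via Lemma 5.1, widened range -/

/-- **(B2) on the widened range** (twin of `norm_vseg_integrandDiff_le`; Lemma 5.1's range is
`|t − 2πt₀| < 𝓛₁ + 2`): for `ψ ∈ Ψ`, `σ = 1/2`, `|t − 2πt₀| < 𝓛₁ + 2`, `X > 0`, `D` large,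
`|(1/2π)∫_{−𝓛²⁰}^{𝓛²⁰} I″(iv)dv| ≤ C·E₂(s,ψ)`. [cite: Zhang2022LandauSiegel, §6 p. 32; §11 Lemma 11.2 p. 65; §12 p. 67] -/
theorem norm_vseg_integrandDiff_le_wide :
    ∃ C : ℝ, ForAllLarge fun D _ χ => ∀ x : Chr D, ∀ s : ℂ, s.re = 1 / 2 →
      |s.im - 2 * π * t0 D| < ell1 D + 2 → ∀ X : ℝ, 0 < X →
        ‖vseg (integrandDiff χ x X (Skeleton.P1 D) s) 0 (ell D ^ 20)‖ ≤ C * E2main χ x s := by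
  obtain ⟨C₅₁, D₀, h51⟩ := lemma51_holds
  refine ⟨|C₅₁|, max D₀ 3, fun D _ χ hD hq hp x s hre him X hX => ?_⟩
  have hD₀ : D₀ ≤ D := le_trans (le_max_left _ _) hD
  have hD3 : 3 ≤ D := le_trans (le_max_right _ _) hD
  have hℓ : 0 ≤ ell D := Real.log_natCast_nonneg D
  have hα : 0 ≤ alpha D := by
    rw [alpha, bigP, Real.log_exp]; positivity
  have hrange : InRange51 D s := by
    refine ⟨?_, by linarith⟩
    rw [hre]; simpa using hα
  set V : ℝ := ell D ^ 20 with hV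
  have hV0 : 0 ≤ V := pow_nonneg hℓ 20
  set F : ℝ → ℂ := fun v => integrandDiff χ x X (Skeleton.P1 D) s (((0 : ℝ) : ℂ) + (v : ℂ) * I) with hF
  set g : ℝ → ℝ := fun v => |C₅₁| * (ell D ^ 68)⁻¹ *
    (‖∑ n ∈ Finset.Ico 1 ⌈Skeleton.P1 D⌉₊, pc χ x n * (n : ℂ) ^ (-(s + v * I))‖ *
      Real.exp (-(v ^ 2) / (4 * ell D ^ 30))) with hg
  -- pointwise bound off `v = 0`, `|v| < V`
  have hpt : ∀ v : ℝ, v ≠ 0 → |v| < V → ‖F v‖ ≤ g v := by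
    intro v hv0 hvV
    have h4 := (h51 D χ hD₀ hq hp x s hrange v hv0 hvV).2.2.2
    have hvI : ((0 : ℝ) : ℂ) + (v : ℂ) * I = v * I := by simp
    set A : ℂ := (Zpc χ x (s + v * I) - Zpc χ x s *
        (((D : ℝ) * bigP D * t0 D : ℝ) : ℂ) ^ (-(v * I))) / (v * I) with hA
    set H : ℂ := headPc χ x (Skeleton.P1 D) s (v * I) with hH
    set S : ℂ := ∑ n ∈ Finset.Ico 1 ⌈Skeleton.P1 D⌉₊, pc χ x n * (n : ℂ) ^ (-(s + v * I)) with hS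
    have hsplit : F v = A * H * (((X : ℝ) : ℂ) ^ ((v : ℂ) * I) * omega1 (ell D ^ 30) (v * I)) := by
      simp only [hF, integrandDiff, kern, hvI, bigR, hA, hH]
      ring
    have hX1 : ‖((X : ℝ) : ℂ) ^ ((v : ℂ) * I)‖ = 1 := by
      rw [Complex.norm_cpow_eq_rpow_re_of_pos hX]; simp
    have hHS : ‖H‖ = ‖S‖ := by rw [hH, hS]; exact norm_headPc_I χ x hre _ v
    have hC : C₅₁ * (ell D ^ 68)⁻¹ ≤ |C₅₁| * (ell D ^ 68)⁻¹ :=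
      mul_le_mul_of_nonneg_right (le_abs_self _) (inv_nonneg.mpr (pow_nonneg hℓ _))
    have hAle : ‖A‖ ≤ |C₅₁| * (ell D ^ 68)⁻¹ := h4.trans hC
    rw [hsplit]
    calc ‖A * H * (((X : ℝ) : ℂ) ^ ((v : ℂ) * I) * omega1 (ell D ^ 30) (v * I))‖
        = ‖A‖ * ‖H‖ * (‖((X : ℝ) : ℂ) ^ ((v : ℂ) * I)‖ * ‖omega1 (ell D ^ 30) (v * I)‖) := by
          simp only [norm_mul]
      _ = ‖A‖ * ‖S‖ * Real.exp (-(v ^ 2) / (4 * ell D ^ 30)) := by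
          rw [hX1, hHS, norm_omega1_I, one_mul]
      _ ≤ |C₅₁| * (ell D ^ 68)⁻¹ * ‖S‖ * Real.exp (-(v ^ 2) / (4 * ell D ^ 30)) :=
          mul_le_mul_of_nonneg_right (mul_le_mul_of_nonneg_right hAle (norm_nonneg _))
            (Real.exp_nonneg _)
      _ = g v := by simp only [hg, hS]; ring
  -- `g` is continuous, hence interval integrable
  have hgc : Continuous g := by
    have hsum : Continuous fun v : ℝ =>
        ∑ n ∈ Finset.Ico 1 ⌈Skeleton.P1 D⌉₊, pc χ x n * (n : ℂ) ^ (-(s + v * I)) := by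
      refine continuous_finsetSum _ fun n hn => ?_
      have hn0 : (n : ℂ) ≠ 0 := by
        have := (Finset.mem_Ico.mp hn).1; exact_mod_cast (by omega : n ≠ 0)
      exact continuous_const.mul (Continuous.const_cpow (by fun_prop) (Or.inl hn0))
    rw [hg]
    fun_prop
  have hgi : IntervalIntegrable g volume (-V) V := hgc.intervalIntegrable _ _
  -- the a.e. form of the pointwise bound on `(-V, V]`
  have hae : ∀ᵐ v : ℝ ∂volume, v ∈ Set.Ioc (-V) V → ‖F v‖ ≤ g v := by
    have h0 : ∀ᵐ v : ℝ ∂volume, v ≠ 0 := by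
      have : ({0}ᶜ : Set ℝ) ∈ ae volume := compl_mem_ae_iff.mpr (measure_singleton _)
      filter_upwards [this] with v hv using hv
    have h1 : ∀ᵐ v : ℝ ∂volume, v ≠ V := by
      have : ({V}ᶜ : Set ℝ) ∈ ae volume := compl_mem_ae_iff.mpr (measure_singleton _)
      filter_upwards [this] with v hv using hv
    filter_upwards [h0, h1] with v hv0 hv1 hv
    rw [Set.mem_Ioc] at hv
    exact hpt v hv0 (abs_lt.mpr ⟨hv.1, lt_of_le_of_ne hv.2 hv1⟩)
  have hint := intervalIntegral.norm_integral_le_of_norm_le (by linarith : -V ≤ V) hae hgi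
  -- `∫ g = |C₅₁|·E₂`
  have hgint : ∫ v in (-V)..V, g v = |C₅₁| * E2main χ x s := by
    rw [hg, E2main, intervalIntegral.integral_const_mul, hV, mul_assoc]
  rw [hgint] at hint
  -- `‖(1/2π)∫F‖ ≤ ‖∫F‖`
  rw [vseg]
  have h2π : ‖(1 / (2 * π) : ℂ)‖ ≤ 1 := by
    have : (1 / (2 * π) : ℂ) = ((1 / (2 * π) : ℝ) : ℂ) := by push_cast; ring
    rw [this, Complex.norm_real, Real.norm_eq_abs, abs_of_pos (by positivity)]
    rw [div_le_one (by positivity)]; linarith [Real.pi_gt_three]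
  calc ‖(1 / (2 * π) : ℂ) * ∫ v in (-V)..V, F v‖
      = ‖(1 / (2 * π) : ℂ)‖ * ‖∫ v in (-V)..V, F v‖ := norm_mul _ _
    _ ≤ 1 * (|C₅₁| * E2main χ x s) := by gcongr
    _ = |C₅₁| * E2main χ x s := one_mul _

end BlocksWide

end Literature.NumberTheory.LFunctions.Zhang2022.Section11AFE
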